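import Literature.Computability.AlgebraicComplexity.ValiantConjectureProofs
import Literature.Computability.AlgebraicComplexity.PermanentUniversality
import Literature.Computability.AlgebraicComplexity.PermanentBooleanSum
import Literature.Computability.AlgebraicComplexity.VNPeEqVNP
import HarnessLib

/-!
# Valiant's theorem: the permanent is `VNP`-complete in characteristic `≠ 2` — discharge of `isVNPComplete_perPoly`

D-0014 keeps `Literature/` free of `sorry` by stating cited results as named facts. This file
discharges the named fact `Literature.Computability.AlgebraicComplexity.isVNPComplete_perPoly`
of `ValiantConjecture.lean` (**pnp.S25**; Valiant 1979; Bürgisser 2000, Thm. 2.10;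
Bürgisser–Clausen–Shokrollahi 1997, Thm. (21.17)(2)): over a field `k` of characteristic `≠ 2`
the permanent family `(PER_n)_n` is `VNP`-complete.

The proof is the assembly `isVNPComplete_perPoly_of` (`PermanentCompleteness.lean`, the outline
of BCS 1997, p. 551 and §21.4) fed with the four discharged steps:

* `PER ∈ VNP` — `isVNPFamily_perPoly_holds` (`ValiantConjectureProofs.lean`, BCS Prop. (21.15));
* `VNP ⊆ VNP_e` — `BCS1997_thm_21_26_holds` (`VNPeEqVNP.lean`, BCS Thm. (21.26));
* universality of the permanent for expressions with the column property (D) —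
  `BCS1997_thm_21_27_holds` (`PermanentUniversality.lean`, BCS Thm. (21.27));
* Boolean sums of such permanents are single permanents of size `≤ 10 N` in characteristic
  `≠ 2` — `BCS1997_thm_21_29_holds` (`PermanentBooleanSum.lean`, BCS Thm. (21.29)).

## References

* L. G. Valiant, *Completeness classes in algebra*, Proc. 11th STOC (1979), 249–261.
* P. Bürgisser, M. Clausen, M. A. Shokrollahi, *Algebraic Complexity Theory*, Grundlehren 315,
  Springer 1997, Thm. (21.17), §21.1–§21.4.
* P. Bürgisser, *Completeness and Reduction in Algebraic Complexity Theory*, Springer 2000,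
  Thm. 2.10.
-/

namespace Literature.Computability.AlgebraicComplexity

universe u

/-- **Valiant's theorem** (discharge of `isVNPComplete_perPoly`, **pnp.S25**): over a field of
characteristic `≠ 2` the permanent family `(PER_n)_n` is `VNP`-complete — every p-definable
family is a p-projection of the permanent (Valiant 1979; BCS 1997, Thm. (21.17)(2) with the proof
of §21.1–§21.4; Bürgisser 2000, Thm. 2.10). [cite: BurgisserClausenShokrollahi1997, Thm. (21.17)] -/
theorem isVNPComplete_perPoly_holds (k : Type u) [Field k] : isVNPComplete_perPoly k :=
  isVNPComplete_perPoly_of k (isVNPFamily_perPoly_holds k) (BCS1997_thm_21_26_holds k)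
    (BCS1997_thm_21_27_holds k) (BCS1997_thm_21_29_holds k)

end Literature.Computability.AlgebraicComplexity
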